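import Literature.NumberTheory.DiophantineGeometry.GenEllThm21
import Literature.NumberTheory.DiophantineGeometry.GenEllNorthcott
import HarnessLib

/-!
# [GenEll] Thm. 2.1, assembly layer: Vojta's inequality from a finite cover, and ε-rescaling

S. Mochizuki, *Arithmetic elliptic curves in general position*, Math. J. Okayama Univ. 52 (2010)
[cite: MochizukiGenEll2010, Thm 2.1 p.12] (kurims manuscript, Feb. 2009), proof of Thm. 2.1, p. 12: the
points of `U_X(Q̄)^{≤d}` are handled by FINITELY MANY mechanisms (the "finite subcover" implicit in
"there exists a subset `Ξ` … converge … to `Ξ_v`", and the contradiction argument), each of which yields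
an inequality of BD-classes of the shape `(1−δ)·ht ≲ (1+ε')(log-diff + log-cond)` with `(1+ε')/(1−δ) ≤ 1+ε`
(p. 13: "`ht_{ω_X} ≲ (1+ε')·log-diff_X + ε'·(deg(E)/deg(ω_X))·ht_{ω_X}` … i.e., that `ht_{ω_X} ≲ (1+ε)·log-diff_X`").

This file records the two purely formal steps of that assembly for `(ℙ¹, [0]+[1]+[∞])` in the tree's
vocabulary (`VojtaIneq S d ε := BDLe (S ∩ U_P(Q̄)^{≤d}) ht ((1+ε)(log-diff + log-cond))`):

* `vojtaIneq_of_scaled` — **ε-rescaling**: `BDLe (S ∩ U^{≤d}) ((1−δ)·ht) ((1+ε')·(log-diff+log-cond))`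
  with `0 < 1−δ` and `(1+ε')/(1−δ) ≤ 1+ε` gives `VojtaIneq S d ε`;
* `vojtaIneq_biUnion` — **finite covers**: Vojta on each of finitely many sets gives Vojta on their union;
  `vojtaP1Deg_of_cover` — if `U_P(Q̄)^{≤d}` is covered by finitely many sets on each of which Vojta holds
  for every `ε > 0`, then `VojtaP1Deg d` ([GenEll] Thm. 2.1 (i) for `ℙ¹`).

Theorems only; no definitions, no named facts. (W9 scaffolding of the GenEllTwo package,
route-ABC-IUTThetaPilot; consumers: the annulus mechanism `vojtaIneq_farFromCusps_two` and the
Belyi-transfer mechanisms.)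
-/

noncomputable section

open NumberField

namespace Literature.NumberTheory.DiophantineGeometry.GenEll

/-! ## ε-rescaling -/

/-- **ε-rescaling** (the last line of the proof of [GenEll] Thm. 2.1, p. 13): if on `S ∩ U_P(Q̄)^{≤d}`
`(1−δ)·ht ≤ (1+ε')·(log-diff + log-cond) + C` with `0 < 1 − δ` and `(1+ε')/(1−δ) ≤ 1+ε`, then
`ht ≲ (1+ε)(log-diff + log-cond)` there, i.e. `VojtaIneq S d ε`. [cite: MochizukiGenEll2010, Thm 2.1 p.13] -/
theorem vojtaIneq_of_scaled {S : Set NFPoint} {d : ℕ} {ε ε' δ : ℝ} (hδ : 0 < 1 - δ)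
    (hε : (1 + ε') / (1 - δ) ≤ 1 + ε)
    (h : BDLe (S ∩ UPle d) (fun P => (1 - δ) * P.ht) (fun P => (1 + ε') * (P.logDiff + P.logCond))) :
    VojtaIneq S d ε := by
  obtain ⟨C, hC⟩ := h
  refine ⟨C / (1 - δ), fun P hP => ?_⟩
  have h1 := hC P hP
  simp only at h1 ⊢
  have hX : 0 ≤ P.logDiff + P.logCond := add_nonneg P.logDiff_nonneg P.logCond_nonneg
  -- `ht ≤ ((1+ε') X + C)/(1−δ) ≤ (1+ε) X + C/(1−δ)`
  have h2 : P.ht ≤ ((1 + ε') * (P.logDiff + P.logCond) + C) / (1 - δ) := by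
    rw [le_div_iff₀ hδ]; linarith
  have h3 : ((1 + ε') * (P.logDiff + P.logCond) + C) / (1 - δ) =
      (1 + ε') / (1 - δ) * (P.logDiff + P.logCond) + C / (1 - δ) := by
    field_simp
  rw [h3] at h2
  have h4 : (1 + ε') / (1 - δ) * (P.logDiff + P.logCond) ≤ (1 + ε) * (P.logDiff + P.logCond) :=
    mul_le_mul_of_nonneg_right hε hX
  linarith

/-! ## Finite covers -/

/-- **Finite covers**: Vojta on each of finitely many sets of points gives Vojta on their union
(BD-classes: a finite maximum of constants). [cite: MochizukiGenEll2010, Thm 2.1 p.12] -/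
theorem vojtaIneq_biUnion {ι : Type*} (s : Finset ι) (T : ι → Set NFPoint) {d : ℕ} {ε : ℝ}
    (h : ∀ i ∈ s, VojtaIneq (T i) d ε) : VojtaIneq (⋃ i ∈ s, T i) d ε := by
  classical
  induction s using Finset.induction_on with
  | empty =>
    refine ⟨0, fun P hP => ?_⟩
    simp at hP
  | insert i s hi ih =>
    have hcur : VojtaIneq (T i) d ε := h i (Finset.mem_insert_self i s)
    have hrest : VojtaIneq (⋃ j ∈ s, T j) d ε := ih fun j hj => h j (Finset.mem_insert_of_mem hj)
    have hunion : VojtaIneq (T i ∪ ⋃ j ∈ s, T j) d ε := by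
      unfold VojtaIneq at hcur hrest ⊢
      rw [Set.union_inter_distrib_right]
      exact bdLe_union_iff.mpr ⟨hcur, hrest⟩
    simpa [Finset.set_biUnion_insert] using hunion

/-- **[GenEll] Thm. 2.1 (i) for `ℙ¹` from a finite cover**: if `U_P(Q̄)^{≤d}` is contained in the union of
finitely many sets of points on each of which `ht ≲ (1+ε)(log-diff + log-cond)` holds in degree `≤ d` for
every `ε > 0`, then `VojtaP1Deg d`. [cite: MochizukiGenEll2010, Thm 2.1 p.12] -/
theorem vojtaP1Deg_of_cover {ι : Type*} (s : Finset ι) (T : ι → Set NFPoint) {d : ℕ}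
    (hcov : UPle d ⊆ ⋃ i ∈ s, T i) (h : ∀ ε : ℝ, 0 < ε → ∀ i ∈ s, VojtaIneq (T i) d ε) :
    VojtaP1Deg d := by
  intro ε hε
  have hU := vojtaIneq_biUnion s T (h ε hε)
  unfold VojtaIneq at hU ⊢
  refine hU.mono ?_
  intro P hP
  exact ⟨hcov hP.2, hP.2⟩

end Literature.NumberTheory.DiophantineGeometry.GenEll

end
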